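import Summits.AtomisticToContinuum.Crystallization.Theorems.ChartedZeroExcessLayeredLatticeLiouvilleZZH

/-!
# (B′.3c) rider ZZK — THE DICTIONARY, PART I: the coded link is RIGID, and a clean charted atom carries a FIRST-SHELL FRAME

Lineage `stmt-AtomisticToContinuum-26636` (route ChartedPlanarOrder, sub Crystallization), lens-2 g80, cone-pin programme (B′) for the open piece
(L2-S) `DoorChartPinningP` at record dials.  This rider joins the two halves of the pin step: the INDEX side (riders ZZG/ZZH/ZZI: the exact
certificate speaks about integer vectors `iota`) and the METRIC side (riders ZZE/ZZJ: cones at physical atoms, one atom's two-shell pattern per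
estimate).  The join is a DICTIONARY at a charted clean atom `Ψ x`: an isometry `F` of `ℝ³` with
`dist (Ψ (linkPt τ x i)) (Ψ x + a • F (iotaPt i)) ≤ a/16` for all twelve link codes `i`, where `iotaPt i = iotaTab i / √18` is the IDEAL position
of code `i` in the integer embedding of rider ZZH (`exists_linkFrame`, `dist_linkPt_frame`).

## The argument (no frame coherence, no metric margins beyond pattern quantisation)
* §ZZK-1 `iotaTab α β i = iota … (linkPt … 0 i)`: the embedded coded link in the letter context `(α, β)`; its contact relation `iotaAdj` (squared
  integer distance `18`) IS the coded Barlow adjacency `linkAdj` (`linkAdj_iff_iotaAdj`, by `decide`), and `refPt 18 ∘ iotaTab` realizes it on the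
  sphere `S²(2)` in the sense of Literature `IsRealization` (`isRealization_iotaRef`).
* §ZZK-2 RIGIDITY OF THE CODED LINK (`iota_rigid`): every realization of `iotaAdj α β` with separation `σ < 8/9` is the image of the reference one
  under a linear isometry — transported from Literature `fcc_rigid` (`α = β`, cuboctahedron) / `hcp_rigid` (`α ≠ β`, anticuboctahedron) along
  explicit code permutations `codePerm` (graph isomorphisms checked by `decide`; the transport `rigid_transport` composes the two isometries).
* §ZZK-3 pattern bookkeeping by `decide`: in either two-shell integer model, two first-shell vectors with positive dot product are equal or in
  contact (`2·dot = N`), and there are exactly `48` ordered first-shell contacts — as many as ordered coded adjacencies.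
* §ZZK-4 THE FRAME (`exists_linkFrame`): at a charted atom `Ψ x` that is `(1/16, 9/10, 1)`-two-shell-good, each link atom `Ψ (linkPt τ x i)` is
  bonded to `Ψ x` (chart), hence a pattern atom `f vᵢ` (coverage `28/25 ≤ 3/2·a`), first-shell (a second-shell atom is `≥ (√2 − 1/16)a > 28/25`
  away); coded-adjacent ⇒ bonded (chart) ⇒ `‖vᵢ − vⱼ‖ < √2` ⇒ pattern contact (§3); COUNTING (48 ordered adjacencies ↦ injectively into the 48
  ordered pattern contacts) gives the converse, so `i ↦ 2vᵢ` is an `IsRealization (iotaAdj α β) 0`, and §2 provides the isometry `G` with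
  `G (iotaPt i) = vᵢ`; `F = A ∘ G`.  Scales of different atoms are never compared; the only thresholds are `28/25` (bond) against the
  quantised pattern distances `a·{1, √2, …}` with `a ∈ [9/10, 1]` and tolerance `a/16`.

0 sorry.  Consumers: the (c1)/(c2) packaging of the pin step ((B′.5)): certificate caps on `iota` vectors transport through `F` to the physical
member / competitor vectors of riders ZZE/ZZJ (`LinearIsometry.inner_map_map`).
-/

open scoped RealInnerProductSpace
open Literature.Geometry.DiscreteGeometry (intVec intVec_apply norm_intVec sqNormInt dotInt refPt inner_refPt IsRealization
  fccAdj hcpAdj fccRef hcpRef fcc_rigid hcp_rigid fccInt hcpInt fccSecondShellInt hcpSecondShellInt fccTwoShellPattern hcpTwoShellPattern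
  scaledPattern IsTwoShellGoodSet)

namespace Summit.AtomisticToContinuum.Crystallization.Theorems.ChartedZeroExcessLayeredLatticeLiouville

open Summit.AtomisticToContinuum.Crystallization.Theorems.ChartedPlanarOrderRigidityDoor (E3)

/-! ## ZZK-1  The embedded coded link and its contact relation -/

/-- the ideal integer embedding (units `1/√18`) of the twelve coded link sites of a vertex with letter `α` on the step below and `β` on the step
above it. [this file, g80] -/
def iotaTab (α β : Bool) (i : Fin 12) : Fin 3 → ℤ := iota (letters4 α α β β) (linkPt (letters4 α α β β) 0 i)

/-- contact relation of the embedded coded link: squared integer distance `18` (one bond). [this file, g80] -/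
abbrev iotaAdj (α β : Bool) (i j : Fin 12) : Prop := sqNormInt (iotaTab α β i - iotaTab α β j) = 18

/-- ★ the coded Barlow adjacency IS the contact relation of the embedding, in every letter context. [this file, g80] -/
theorem linkAdj_iff_iotaAdj : ∀ α β : Bool, ∀ i j : Fin 12, linkAdj α β i j = true ↔ iotaAdj α β i j := by decide

/-- embedded link sites have squared norm `18`. [this file, g80] -/
theorem dotInt_iotaTab_self : ∀ α β : Bool, ∀ i : Fin 12, dotInt (iotaTab α β i) (iotaTab α β i) = 18 := by decide

/-- contacts have dot product `9`. [this file, g80] -/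
theorem dotInt_iotaTab_adj : ∀ α β : Bool, ∀ i j : Fin 12, iotaAdj α β i j → dotInt (iotaTab α β i) (iotaTab α β j) = 9 := by decide

/-- distinct non-contacts have dot product `≤ 0` (values `0, −6, −9, −15, −18`). [this file, g80] -/
theorem dotInt_iotaTab_non : ∀ α β : Bool, ∀ i j : Fin 12, i ≠ j → ¬ iotaAdj α β i j →
    dotInt (iotaTab α β i) (iotaTab α β j) ≤ 0 := by decide

/-- exactly `48` ordered coded adjacencies (a `12`-vertex `4`-regular link), in every letter context. [this file, g80] -/
theorem card_iotaAdj : ∀ α β : Bool, (Finset.univ.filter fun p : Fin 12 × Fin 12 => iotaAdj α β p.1 p.2).card = 48 := by decide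

/-- the ideal position of code `i` at unit bond length. [this file, g80] -/
noncomputable def iotaPt (α β : Bool) (i : Fin 12) : E3 := (Real.sqrt 18)⁻¹ • intVec (iotaTab α β i)

/-- the reference configuration on `S²(2)` (Literature `refPt` idiom). [this file, g80] -/
noncomputable abbrev iotaRef (α β : Bool) (i : Fin 12) : E3 := refPt 18 (iotaTab α β i)

/-- [formal bookkeeping] -/
theorem two_smul_iotaPt (α β : Bool) (i : Fin 12) : (2 : ℝ) • iotaPt α β i = iotaRef α β i := rfl

/-- the reference configuration realizes the contact relation with separation `0`. [this file, g80] -/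
theorem isRealization_iotaRef (α β : Bool) : IsRealization (iotaAdj α β) 0 (iotaRef α β) := by
  refine ⟨by norm_num, fun i => ?_, fun i j h => ?_, fun i j h hn => ?_⟩
  · rw [inner_refPt, dotInt_iotaTab_self α β i]; norm_num
  · rw [inner_refPt, dotInt_iotaTab_adj α β i j h]; norm_num
  · rw [inner_refPt]
    have h0 : (dotInt (iotaTab α β i) (iotaTab α β j) : ℝ) ≤ 0 := by exact_mod_cast dotInt_iotaTab_non α β i j h hn
    exact mul_nonpos_of_nonneg_of_nonpos (by norm_num) h0

/-! ## ZZK-2  Rigidity of the coded link, transported from `fcc_rigid` / `hcp_rigid` -/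

/-- the code permutation onto Literature's `fccTab` (`α = β`) resp. `hcpTab` (`α ≠ β`) enumeration (a graph isomorphism, found offline). [this file, g80] -/
def codePerm (α β : Bool) : Fin 12 → Fin 12 :=
  match α, β with
  | true, true => ![0, 4, 10, 3, 7, 9, 8, 6, 2, 11, 5, 1]
  | true, false => ![0, 2, 4, 1, 3, 5, 8, 7, 6, 11, 10, 9]
  | false, true => ![0, 5, 3, 1, 4, 2, 7, 8, 6, 10, 11, 9]
  | false, false => ![0, 4, 10, 3, 7, 9, 11, 5, 1, 8, 6, 2]

/-- its inverse. [this file, g80] -/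
def codePermInv (α β : Bool) : Fin 12 → Fin 12 :=
  match α, β with
  | true, true => ![0, 11, 8, 3, 1, 10, 7, 4, 6, 5, 2, 9]
  | true, false => ![0, 3, 1, 4, 2, 5, 8, 7, 6, 11, 10, 9]
  | false, true => ![0, 3, 5, 2, 4, 1, 8, 6, 7, 11, 9, 10]
  | false, false => ![0, 8, 11, 3, 1, 7, 10, 4, 9, 5, 2, 6]

/-- [formal bookkeeping] -/
theorem codePermInv_codePerm : ∀ α β : Bool, ∀ i : Fin 12, codePermInv α β (codePerm α β i) = i := by decide

/-- [formal bookkeeping] -/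
theorem codePerm_codePermInv : ∀ α β : Bool, ∀ j : Fin 12, codePerm α β (codePermInv α β j) = j := by decide

/-- context `(true, true)`: the coded link is the cuboctahedron graph. [this file, g80] -/
theorem iotaAdj_tt : ∀ i j : Fin 12, iotaAdj true true i j ↔ fccAdj (codePerm true true i) (codePerm true true j) := by decide
/-- context `(false, false)`: the coded link is the cuboctahedron graph. [this file, g80] -/
theorem iotaAdj_ff : ∀ i j : Fin 12, iotaAdj false false i j ↔ fccAdj (codePerm false false i) (codePerm false false j) := by decide
/-- context `(true, false)`: the coded link is the anticuboctahedron graph. [this file, g80] -/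
theorem iotaAdj_tf : ∀ i j : Fin 12, iotaAdj true false i j ↔ hcpAdj (codePerm true false i) (codePerm true false j) := by decide
/-- context `(false, true)`: the coded link is the anticuboctahedron graph. [this file, g80] -/
theorem iotaAdj_ft : ∀ i j : Fin 12, iotaAdj false true i j ↔ hcpAdj (codePerm false true i) (codePerm false true j) := by decide

/-- ★ TRANSPORT OF RIGIDITY along a graph isomorphism `π` (inverse `ρ`): if every realization of `adj₀` is the isometric image of `ref₀`, and `ref`
realizes `adj ≅ adj₀`, then every realization of `adj` is the isometric image of `ref` (compose the isometry onto `x ∘ ρ` with the inverse of the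
one onto `ref ∘ ρ`). [this file, g80] -/
theorem rigid_transport {adj adj₀ : Fin 12 → Fin 12 → Prop} {ref ref₀ : Fin 12 → E3} (π ρ : Fin 12 → Fin 12)
    (hρπ : ∀ i, ρ (π i) = i) (hπρ : ∀ j, π (ρ j) = j) (hadj : ∀ i j, adj i j ↔ adj₀ (π i) (π j))
    (rigid₀ : ∀ {σ : ℝ} {x : Fin 12 → E3}, IsRealization adj₀ σ x → ∃ A : E3 →ₗᵢ[ℝ] E3, ∀ j, A (ref₀ j) = x j)
    (href : IsRealization adj 0 ref) {σ : ℝ} {x : Fin 12 → E3} (hx : IsRealization adj σ x) :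
    ∃ A : E3 →ₗᵢ[ℝ] E3, ∀ i, A (ref i) = x i := by
  have hadj' : ∀ j j', adj₀ j j' ↔ adj (ρ j) (ρ j') := fun j j' => by rw [hadj, hπρ, hπρ]
  have pull : ∀ {σ' : ℝ} {y : Fin 12 → E3}, IsRealization adj σ' y → IsRealization adj₀ σ' (fun j => y (ρ j)) := by
    intro σ' y hy
    refine ⟨hy.sigma_lt, fun j => hy.inner_self (ρ j), fun j j' h => hy.inner_adj ((hadj' j j').1 h), fun j j' hne hn => hy.inner_le ?_ ?_⟩
    · intro h; exact hne (by rw [← hπρ j, ← hπρ j', h])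
    · rwa [← hadj']
  obtain ⟨A₁, hA₁⟩ := rigid₀ (pull hx)
  obtain ⟨A₂, hA₂⟩ := rigid₀ (pull href)
  let A₂e : E3 ≃ₗᵢ[ℝ] E3 := A₂.toLinearIsometryEquiv rfl
  have hA₂e : ∀ v, A₂e v = A₂ v := fun v => congrFun (LinearIsometry.coe_toLinearIsometryEquiv A₂ rfl) v
  refine ⟨A₁.comp A₂e.symm.toLinearIsometry, fun i => ?_⟩
  have h1 : ref i = A₂e (ref₀ (π i)) := by rw [hA₂e, hA₂, hρπ]
  show A₁ (A₂e.symm (ref i)) = x i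
  rw [h1, LinearIsometryEquiv.symm_apply_apply, hA₁, hρπ]

/-- ★★ RIGIDITY OF THE CODED LINK: every realization (separation `σ < 8/9`) of the coded Barlow adjacency of a vertex, in any letter context, is
the image of the ideal embedding `iotaRef` under a linear isometry of `ℝ³`. [this file, g80; Literature `fcc_rigid` / `hcp_rigid`] -/
theorem iota_rigid (α β : Bool) {σ : ℝ} {x : Fin 12 → E3} (hx : IsRealization (iotaAdj α β) σ x) :
    ∃ A : E3 →ₗᵢ[ℝ] E3, ∀ i, A (iotaRef α β i) = x i := by
  cases α <;> cases β
  · exact rigid_transport (codePerm false false) (codePermInv false false) (codePermInv_codePerm _ _) (codePerm_codePermInv _ _)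
      iotaAdj_ff (fun h => fcc_rigid h) (isRealization_iotaRef _ _) hx
  · exact rigid_transport (codePerm false true) (codePermInv false true) (codePermInv_codePerm _ _) (codePerm_codePermInv _ _)
      iotaAdj_ft (fun h => hcp_rigid h) (isRealization_iotaRef _ _) hx
  · exact rigid_transport (codePerm true false) (codePermInv true false) (codePermInv_codePerm _ _) (codePerm_codePermInv _ _)
      iotaAdj_tf (fun h => hcp_rigid h) (isRealization_iotaRef _ _) hx
  · exact rigid_transport (codePerm true true) (codePermInv true true) (codePermInv_codePerm _ _) (codePerm_codePermInv _ _)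
      iotaAdj_tt (fun h => fcc_rigid h) (isRealization_iotaRef _ _) hx

/-! ## ZZK-3  Pattern bookkeeping: positive dot products are contacts; `48` ordered contacts -/

/-- fcc two-shell model (`N = 2`): first-shell vectors with positive dot product are equal or in contact. [folklore] -/
theorem fcc_dot_pos : ∀ s ∈ fccInt ∪ fccSecondShellInt, ∀ t ∈ fccInt ∪ fccSecondShellInt,
    sqNormInt s = 2 → sqNormInt t = 2 → 0 < dotInt s t → s = t ∨ 2 * dotInt s t = 2 := by decide

/-- hcp two-shell model (`N = 18`): first-shell vectors with positive dot product are equal or in contact. [folklore] -/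
theorem hcp_dot_pos : ∀ s ∈ hcpInt ∪ hcpSecondShellInt, ∀ t ∈ hcpInt ∪ hcpSecondShellInt,
    sqNormInt s = 18 → sqNormInt t = 18 → 0 < dotInt s t → s = t ∨ 2 * dotInt s t = 18 := by decide

/-- fcc: exactly `48` ordered first-shell contacts. [folklore] -/
theorem fcc_card_contacts : (((fccInt ∪ fccSecondShellInt) ×ˢ (fccInt ∪ fccSecondShellInt)).filter
    fun p => sqNormInt p.1 = 2 ∧ sqNormInt p.2 = 2 ∧ 2 * dotInt p.1 p.2 = 2).card = 48 := by decide

/-- hcp: exactly `48` ordered first-shell contacts. [folklore] -/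
theorem hcp_card_contacts : (((hcpInt ∪ hcpSecondShellInt) ×ˢ (hcpInt ∪ hcpSecondShellInt)).filter
    fun p => sqNormInt p.1 = 18 ∧ sqNormInt p.2 = 18 ∧ 2 * dotInt p.1 p.2 = 18).card = 48 := by decide

/-- first or second shell. [folklore] -/
theorem fcc_sqNorm : ∀ s ∈ fccInt ∪ fccSecondShellInt, sqNormInt s = 2 ∨ sqNormInt s = 2 * 2 := by decide

/-- first or second shell. [folklore] -/
theorem hcp_sqNorm : ∀ s ∈ hcpInt ∪ hcpSecondShellInt, sqNormInt s = 18 ∨ sqNormInt s = 2 * 18 := by decide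

/-! ## ZZK-4  The first-shell frame of a charted clean atom -/

section Frame

/-- [formal bookkeeping] (lane edit hand-2 g39: ONE `private` token — `dedup.landed` vs `Literature.Geometry.DiscreteGeometry.dotInt_self`; body verbatim, used only here.) -/
private theorem dotInt_self_eq (s : Fin 3 → ℤ) : dotInt s s = sqNormInt s := by unfold dotInt sqNormInt; ring

/-- squared norm of a scaled integer vector. [formal bookkeeping] -/
theorem norm_scaled_sq {N : ℕ} (hN : 0 < N) (s : Fin 3 → ℤ) :
    ‖(Real.sqrt N)⁻¹ • intVec s‖ ^ 2 = (sqNormInt s : ℝ) / N := by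
  have hN' : (0 : ℝ) < N := by exact_mod_cast hN
  rw [norm_smul, norm_inv, Real.norm_of_nonneg (Real.sqrt_nonneg _), norm_intVec, mul_pow, inv_pow, Real.sq_sqrt hN'.le,
    Real.sq_sqrt (by exact_mod_cast (show (0 : ℤ) ≤ sqNormInt s by unfold sqNormInt; positivity))]  -- lane edit hand-2 g39: ZZH's lemma is `private` in tree
  field_simp

/-- inner product of scaled integer vectors. [formal bookkeeping] -/
theorem inner_scaled {N : ℕ} (hN : 0 < N) (s t : Fin 3 → ℤ) :
    ⟪(Real.sqrt N)⁻¹ • intVec s, (Real.sqrt N)⁻¹ • intVec t⟫ = (dotInt s t : ℝ) / N := by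
  have hN' : (0 : ℝ) ≤ N := by positivity
  rw [real_inner_smul_left, real_inner_smul_right, Literature.Geometry.DiscreteGeometry.inner_intVec, ← mul_assoc, ← mul_inv,
    Real.mul_self_sqrt hN', inv_mul_eq_div]

/-- ★ the integer heart of the frame: at a charted atom with a `1/16`-matched pattern `I/√N` at ANY scale `a ≥ 9/10` (no upper bound and no
injectivity of the assignment are needed), the twelve link atoms are first-shell pattern atoms `sᵢ/√N` and `i ↦ refPt N sᵢ` realizes the coded
adjacency with separation `0`. [this file, g80] -/
theorem linkRealization_aux {S : Set E3} {D : Set (ℤ × ℤ × ℤ)} {Ψ : ℤ × ℤ × ℤ → E3} {τ : ℤ → Bool} {x : ℤ × ℤ × ℤ}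
    (hΨ : IsBarlowBondChart S D Ψ τ) (hxD : x ∈ D) (hlD : ∀ i, linkPt τ x i ∈ D)
    {I : Finset (Fin 3 → ℤ)} {N : ℕ} (hN : 0 < N)
    (hnorm : ∀ s ∈ I, sqNormInt s = N ∨ sqNormInt s = 2 * N)
    (hpos : ∀ s ∈ I, ∀ t ∈ I, sqNormInt s = N → sqNormInt t = N → 0 < dotInt s t → s = t ∨ 2 * dotInt s t = N)
    (hcard : ((I ×ˢ I).filter fun p => sqNormInt p.1 = N ∧ sqNormInt p.2 = N ∧ 2 * dotInt p.1 p.2 = N).card = 48)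
    {a : ℝ} (ha : 9 / 10 ≤ a) {A : E3 →ₗᵢ[ℝ] E3} {f : E3 → E3}
    (hf : ∀ v ∈ scaledPattern I N, f v ∈ S ∧ dist (f v) (Ψ x + a • A v) ≤ 1 / 16 * a)
    (hcov : ∀ y ∈ S, y ≠ Ψ x → dist y (Ψ x) ≤ 3 / 2 * a → ∃ v ∈ scaledPattern I N, f v = y) :
    ∃ s : Fin 12 → (Fin 3 → ℤ), (∀ i, s i ∈ I) ∧ (∀ i, sqNormInt (s i) = N) ∧
      (∀ i, f ((Real.sqrt N)⁻¹ • intVec (s i)) = Ψ (linkPt τ x i)) ∧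
      IsRealization (iotaAdj (τ (x.1 - 1)) (τ x.1)) 0 (fun i => refPt N (s i)) := by
  have hN' : (0 : ℝ) < N := by exact_mod_cast hN
  have hapos : 0 < a := by linarith
  -- the link atoms are bonded to `Ψ x`, hence pattern atoms
  have hbond : ∀ i, IsBond (Ψ x) (Ψ (linkPt τ x i)) := fun i => (hΨ.2.2 x hxD _ (hlD i)).2 (barlowAdj_linkPt τ x i)
  have key : ∀ i, ∃ s ∈ I, f ((Real.sqrt N)⁻¹ • intVec s) = Ψ (linkPt τ x i) := by
    intro i
    obtain ⟨h0, h1⟩ := hbond i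
    obtain ⟨v, hv, hfv⟩ := hcov _ (hΨ.2.1 (hlD i)) (fun h => by rw [h, dist_self] at h0; exact lt_irrefl _ h0)
      (by rw [dist_comm]; linarith)
    obtain ⟨s, hs, rfl⟩ := Finset.mem_image.1 hv
    exact ⟨s, hs, hfv⟩
  choose s hsI hs using key
  have hmem : ∀ i, (Real.sqrt N)⁻¹ • intVec (s i) ∈ scaledPattern I N := fun i => Finset.mem_image_of_mem _ (hsI i)
  -- the displacement of a pattern atom from its ideal position, and the norm bookkeeping
  have hnear : ∀ i, dist (Ψ (linkPt τ x i)) (Ψ x + a • A ((Real.sqrt N)⁻¹ • intVec (s i))) ≤ 1 / 16 * a := fun i => by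
    rw [← hs i]; exact (hf _ (hmem i)).2
  have hnormA : ∀ v : E3, ‖a • A v‖ = a * ‖v‖ := fun v => by rw [norm_smul, Real.norm_of_nonneg hapos.le, A.norm_map]
  -- (1) first shell
  have h1 : ∀ i, sqNormInt (s i) = N := by
    intro i
    rcases hnorm _ (hsI i) with h | h
    · exact h
    exfalso
    set u : E3 := (Real.sqrt N)⁻¹ • intVec (s i)
    have hu2 : ‖u‖ ^ 2 = 2 := by
      have hc : ((sqNormInt (s i) : ℤ) : ℝ) = 2 * (N : ℝ) := by rw [h]; push_cast; ring
      rw [norm_scaled_sq hN, hc]; field_simp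
    have hd : a * ‖u‖ ≤ 1 / 16 * a + 28 / 25 := by
      rw [← hnormA]
      calc ‖a • A u‖ = dist (Ψ x + a • A u) (Ψ x) := by rw [dist_eq_norm, add_sub_cancel_left]
        _ ≤ dist (Ψ x + a • A u) (Ψ (linkPt τ x i)) + dist (Ψ (linkPt τ x i)) (Ψ x) := dist_triangle _ _ _
        _ ≤ 1 / 16 * a + 28 / 25 := by rw [dist_comm] ; exact add_le_add (hnear i) (by rw [dist_comm]; exact (hbond i).2)
    have hsq : (a * ‖u‖) ^ 2 ≤ (1 / 16 * a + 28 / 25) ^ 2 := pow_le_pow_left₀ (by positivity) hd 2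
    rw [mul_pow, hu2] at hsq
    nlinarith
  have hunit : ∀ i, ‖(Real.sqrt N)⁻¹ • intVec (s i)‖ ^ 2 = 1 := fun i => by
    rw [norm_scaled_sq hN, h1 i]; push_cast; field_simp
  -- (2) injectivity of the labelling
  have hsinj : Function.Injective s := by
    intro i j hij
    have h := hs i
    rw [hij, hs j] at h
    exact linkPt_injective τ x (hΨ.1 (hlD j) (hlD i) h).symm
  -- (3) coded-adjacent ⇒ pattern contact
  have hadj : ∀ i j, iotaAdj (τ (x.1 - 1)) (τ x.1) i j → 2 * dotInt (s i) (s j) = N := by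
    intro i j hij
    have hB : BarlowAdj τ (linkPt τ x i) (linkPt τ x j) :=
      (barlowAdj_linkPt_iff τ x i j).2 ((linkAdj_iff_iotaAdj _ _ i j).2 hij)
    obtain ⟨h0, hb⟩ := (hΨ.2.2 _ (hlD i) _ (hlD j)).2 hB
    have hne : i ≠ j := by rintro rfl; rw [dist_self] at h0; exact lt_irrefl _ h0
    set u : E3 := (Real.sqrt N)⁻¹ • intVec (s i)
    set u' : E3 := (Real.sqrt N)⁻¹ • intVec (s j)
    have hd : a * ‖u - u'‖ ≤ 28 / 25 + (1 / 16 * a + 1 / 16 * a) := by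
      rw [← hnormA, map_sub, smul_sub]
      calc ‖a • A u - a • A u'‖ = dist (Ψ x + a • A u) (Ψ x + a • A u') := by rw [dist_eq_norm, add_sub_add_left_eq_sub]
        _ ≤ dist (Ψ x + a • A u) (Ψ (linkPt τ x i)) + dist (Ψ (linkPt τ x i)) (Ψ x + a • A u') := dist_triangle _ _ _
        _ ≤ 1 / 16 * a + (dist (Ψ (linkPt τ x i)) (Ψ (linkPt τ x j)) + dist (Ψ (linkPt τ x j)) (Ψ x + a • A u')) :=
            add_le_add (by rw [dist_comm]; exact hnear i) (dist_triangle _ _ _)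
        _ ≤ 1 / 16 * a + (28 / 25 + 1 / 16 * a) := by gcongr; exact hnear j
        _ = 28 / 25 + (1 / 16 * a + 1 / 16 * a) := by ring
    have hsq : (a * ‖u - u'‖) ^ 2 ≤ (28 / 25 + (1 / 16 * a + 1 / 16 * a)) ^ 2 := pow_le_pow_left₀ (by positivity) hd 2
    have hexp : ‖u - u'‖ ^ 2 = 2 - 2 * ((dotInt (s i) (s j) : ℝ) / N) := by
      rw [norm_sub_sq_real, hunit i, hunit j, inner_scaled hN]; ring
    rw [mul_pow, hexp] at hsq
    have hdpos : 0 < dotInt (s i) (s j) := by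
      by_contra hle
      push Not at hle
      have hle' : (dotInt (s i) (s j) : ℝ) / N ≤ 0 := div_nonpos_of_nonpos_of_nonneg (by exact_mod_cast hle) hN'.le
      nlinarith
    rcases hpos _ (hsI i) _ (hsI j) (h1 i) (h1 j) hdpos with h | h
    · exact absurd (hsinj h) hne
    · exact h
  -- (4) counting: the converse
  set α := τ (x.1 - 1)
  set β := τ x.1
  set E : Finset (Fin 12 × Fin 12) := Finset.univ.filter fun p : Fin 12 × Fin 12 => iotaAdj α β p.1 p.2
  set C : Finset ((Fin 3 → ℤ) × (Fin 3 → ℤ)) :=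
    (I ×ˢ I).filter fun p => sqNormInt p.1 = N ∧ sqNormInt p.2 = N ∧ 2 * dotInt p.1 p.2 = N
  let φ : Fin 12 × Fin 12 → (Fin 3 → ℤ) × (Fin 3 → ℤ) := fun p => (s p.1, s p.2)
  have hφ : Function.Injective φ := by
    rintro ⟨i, j⟩ ⟨i', j'⟩ h
    simp only [φ, Prod.mk.injEq] at h
    rw [hsinj h.1, hsinj h.2]
  have himg : E.image φ = C := by
    apply Finset.eq_of_subset_of_card_le
    · intro q hq
      obtain ⟨p, hp, rfl⟩ := Finset.mem_image.1 hq
      have hp' : iotaAdj α β p.1 p.2 := (Finset.mem_filter.1 hp).2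
      exact Finset.mem_filter.2 ⟨Finset.mem_product.2 ⟨hsI _, hsI _⟩, h1 _, h1 _, hadj _ _ hp'⟩
    · rw [Finset.card_image_of_injective _ hφ, hcard, card_iotaAdj]
  have hnon : ∀ i j, i ≠ j → ¬ iotaAdj α β i j → dotInt (s i) (s j) ≤ 0 := by
    intro i j hne hn
    by_contra hlt
    push Not at hlt
    rcases hpos _ (hsI i) _ (hsI j) (h1 i) (h1 j) hlt with h | h
    · exact hne (hsinj h)
    have hC : (s i, s j) ∈ C := Finset.mem_filter.2 ⟨Finset.mem_product.2 ⟨hsI i, hsI j⟩, h1 i, h1 j, h⟩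
    rw [← himg] at hC
    obtain ⟨p, hp, hpq⟩ := Finset.mem_image.1 hC
    have hpij : p = (i, j) := hφ (by simpa [φ] using hpq)
    subst hpij
    exact hn (Finset.mem_filter.1 hp).2
  -- (5) the realization
  refine ⟨s, hsI, h1, hs, by norm_num, fun i => ?_, fun i j h => ?_, fun i j h hn => ?_⟩
  · rw [inner_refPt, dotInt_self_eq, h1 i]; push_cast; field_simp
  · have h2 : (dotInt (s i) (s j) : ℝ) = N / 2 := by
      have := hadj i j h
      have h' : (2 : ℝ) * dotInt (s i) (s j) = N := by exact_mod_cast this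
      linarith
    rw [inner_refPt, h2]; field_simp; ring
  · rw [inner_refPt]
    have h0 : (dotInt (s i) (s j) : ℝ) ≤ 0 := by exact_mod_cast hnon i j h hn
    exact mul_nonpos_of_nonneg_of_nonpos (by positivity) h0

/-- ★★★ **THE FIRST-SHELL FRAME OF A CHARTED CLEAN ATOM.**  Let `Ψ, τ` be a Barlow bond chart of `S` on `D ∋ x` containing the link of `x`, and let
`Ψ x` be `(1/16, 9/10, 1)`-two-shell-good in `S`, with witnesses `a, A, P, f`.  Then there is a linear isometry `G` of `ℝ³` carrying the IDEAL link
positions `iotaPt i` (rider ZZH's integer embedding, letter context `(τ (x.1−1), τ x.1)`) INTO THE PATTERN, `G (iotaPt i) ∈ P`, with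
`f (G (iotaPt i)) = Ψ (linkPt τ x i)` for all twelve codes: the chart's link of `x` is the first shell of the clean pattern, in the ideal order, up to
the pattern tolerance `a/16` around `Ψ x + a • A (G (iotaPt i))`. [this file, g80] -/
theorem exists_linkFrame {S : Set E3} {D : Set (ℤ × ℤ × ℤ)} {Ψ : ℤ × ℤ × ℤ → E3} {τ : ℤ → Bool} {x : ℤ × ℤ × ℤ}
    (hΨ : IsBarlowBondChart S D Ψ τ) (hxD : x ∈ D) (hlD : ∀ i, linkPt τ x i ∈ D)
    (hgood : IsTwoShellGoodSet (1 / 16) (9 / 10) 1 S (Ψ x)) :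
    ∃ a : ℝ, 9 / 10 ≤ a ∧ a ≤ 1 ∧ ∃ (A : E3 →ₗᵢ[ℝ] E3) (P : Finset E3) (f : E3 → E3) (G : E3 →ₗᵢ[ℝ] E3),
      (P = fccTwoShellPattern ∨ P = hcpTwoShellPattern) ∧ (∀ v ∈ P, f v ∈ S ∧ dist (f v) (Ψ x + a • A v) ≤ 1 / 16 * a) ∧
      Set.InjOn f ↑P ∧ (∀ y ∈ S, y ≠ Ψ x → dist y (Ψ x) ≤ 3 / 2 * a → ∃ v ∈ P, f v = y) ∧
      ∀ i : Fin 12, G (iotaPt (τ (x.1 - 1)) (τ x.1) i) ∈ P ∧ f (G (iotaPt (τ (x.1 - 1)) (τ x.1) i)) = Ψ (linkPt τ x i) := by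
  obtain ⟨a, ha, ha1, A, P, f, hP, hf, hinj, hcov⟩ := hgood
  -- uniform treatment of the two models
  have main : ∀ (I : Finset (Fin 3 → ℤ)) (N : ℕ), 0 < N → P = scaledPattern I N →
      (∀ s ∈ I, sqNormInt s = N ∨ sqNormInt s = 2 * N) →
      (∀ s ∈ I, ∀ t ∈ I, sqNormInt s = N → sqNormInt t = N → 0 < dotInt s t → s = t ∨ 2 * dotInt s t = N) →
      ((I ×ˢ I).filter fun p => sqNormInt p.1 = N ∧ sqNormInt p.2 = N ∧ 2 * dotInt p.1 p.2 = N).card = 48 →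
      ∃ G : E3 →ₗᵢ[ℝ] E3, ∀ i : Fin 12, G (iotaPt (τ (x.1 - 1)) (τ x.1) i) ∈ P ∧
        f (G (iotaPt (τ (x.1 - 1)) (τ x.1) i)) = Ψ (linkPt τ x i) := by
    intro I N hN hPI hnorm hpos hcard
    subst hPI
    obtain ⟨s, hsI, -, hs, hreal⟩ := linkRealization_aux hΨ hxD hlD hN hnorm hpos hcard ha hf hcov
    obtain ⟨G, hG⟩ := iota_rigid _ _ hreal
    have hGpt : ∀ i, G (iotaPt (τ (x.1 - 1)) (τ x.1) i) = (Real.sqrt N)⁻¹ • intVec (s i) := by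
      intro i
      have h := hG i
      rw [← two_smul_iotaPt, map_smul, refPt] at h
      exact smul_right_injective E3 (two_ne_zero (α := ℝ)) h
    exact ⟨G, fun i => ⟨by rw [hGpt]; exact Finset.mem_image_of_mem _ (hsI i), by rw [hGpt, hs]⟩⟩
  refine ⟨a, ha, ha1, A, P, f, ?_⟩
  rcases hP with hP | hP
  · obtain ⟨G, hG⟩ := main _ 2 two_pos (by rw [hP]; rfl) fcc_sqNorm fcc_dot_pos fcc_card_contacts
    exact ⟨G, Or.inl hP, hf, hinj, hcov, hG⟩
  · obtain ⟨G, hG⟩ := main _ 18 (by norm_num) (by rw [hP]; rfl) hcp_sqNorm hcp_dot_pos hcp_card_contacts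
    exact ⟨G, Or.inr hP, hf, hinj, hcov, hG⟩

/-- ★★ COROLLARY (the dictionary in the form the pin step consumes): an isometry `F = A ∘ G` with
`dist (Ψ (linkPt τ x i)) (Ψ x + a • F (iotaPt i)) ≤ a/16` for all twelve link codes. [this file, g80] -/
theorem dist_linkPt_frame {S : Set E3} {D : Set (ℤ × ℤ × ℤ)} {Ψ : ℤ × ℤ × ℤ → E3} {τ : ℤ → Bool} {x : ℤ × ℤ × ℤ}
    (hΨ : IsBarlowBondChart S D Ψ τ) (hxD : x ∈ D) (hlD : ∀ i, linkPt τ x i ∈ D)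
    (hgood : IsTwoShellGoodSet (1 / 16) (9 / 10) 1 S (Ψ x)) :
    ∃ a : ℝ, 9 / 10 ≤ a ∧ a ≤ 1 ∧ ∃ F : E3 →ₗᵢ[ℝ] E3,
      ∀ i : Fin 12, dist (Ψ (linkPt τ x i)) (Ψ x + a • F (iotaPt (τ (x.1 - 1)) (τ x.1) i)) ≤ 1 / 16 * a := by
  obtain ⟨a, ha, ha1, A, P, f, G, -, hf, -, -, hG⟩ := exists_linkFrame hΨ hxD hlD hgood
  refine ⟨a, ha, ha1, A.comp G, fun i => ?_⟩
  obtain ⟨hmem, hfi⟩ := hG i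
  rw [← hfi, LinearIsometry.coe_comp, Function.comp_apply]
  exact (hf _ hmem).2

/-- unit-length ideal positions: `‖iotaPt i‖ = 1`. [this file, g80] -/
theorem norm_iotaPt (α β : Bool) (i : Fin 12) : ‖iotaPt α β i‖ = 1 := by
  have hsq : (sqNormInt (iotaTab α β i) : ℝ) = 18 := by
    rw [← dotInt_self_eq]; exact_mod_cast dotInt_iotaTab_self α β i
  have h := norm_scaled_sq (N := 18) (by norm_num) (iotaTab α β i)
  rw [show ((18 : ℕ) : ℝ) = 18 from by norm_num, hsq] at h
  have h2 : ‖iotaPt α β i‖ ^ 2 = 1 := by rw [iotaPt, h]; norm_num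
  have h0 : 0 ≤ ‖iotaPt α β i‖ := norm_nonneg _
  nlinarith

/-- RECORD NUMEROLOGY of the frame (the three margins used above, at the extreme scales `a ∈ [9/10, 1]`): bond `28/25 ≤ 3/2·(9/10)` (coverage);
second shell excluded `(1/16·a + 28/25)² < 2a²`; adjacency `(28/25 + a/8)² < 2a²` — both at `a = 9/10`, where they are tightest. [this file, g80] -/
theorem linkFrame_record_numerology :
    (28 : ℝ) / 25 ≤ 3 / 2 * (9 / 10) ∧ ((1 : ℝ) / 16 * (9 / 10) + 28 / 25) ^ 2 < 2 * (9 / 10) ^ 2 ∧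
      ((28 : ℝ) / 25 + (1 / 16 * (9 / 10) + 1 / 16 * (9 / 10))) ^ 2 < 2 * (9 / 10) ^ 2 := by norm_num

end Frame

end Summit.AtomisticToContinuum.Crystallization.Theorems.ChartedZeroExcessLayeredLatticeLiouville
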